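import Mathlib
import Literature.Computability.AlgebraicComplexity.HessianRank
import HarnessLib

/-!
# Crux `GrenetZeon.PolySizeQPAlgebra` (stmt-ValiantsHypothesis-8064), line `vbp-slice-dealg` —
# second-order Taylor expansion through the jet ring `R[η][ε]`

The type-independent local Hessian bound (`…LocalReduction`, input `LocalHessianBound n`) needs the
second partials `∂_s ∂_t det A (p)` of an affine determinant over an ARBITRARY finite-dimensional
commutative coefficient algebra `R` at points where the value matrix `A(p)` has no unimodular kernel
vector (residual corank `≥ 2`).  The tree computes such partials through kernel vectors
(`…ResidualCorankOne`); this file provides the general device used for the residual-corank-two case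
(`…ResidualCorankTwo`): the substitution `X_u ↦ x_u + [u = s] ε + [u = t] η` into the jet ring
`R[η][ε] = DualNumber (DualNumber R)` (`ε² = η² = 0`, `εη ≠ 0`), whose `εη`-coefficient is EXACTLY
`∂_s ∂_t f (x)` (also for `s = t`, since `(ε + η)² = 2εη`) — Taylor's formula to second order with no
division and no analysis, so that determinants can afterwards be expanded with Mathlib's block and
`det (1 + r • M)` identities over the commutative ring `R[η][ε]`.

* `fst_fst_mul`, `fst_snd_mul`, `snd_fst_mul`, `snd_snd_mul` — the four components
  (`1, η, ε, εη`) of a product in `R[η][ε]`; components of `ε`, `η` and of constants.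
* `aeval_jet₂_eq` — **the jet identity**: the four components of `f(x + [·=s]ε + [·=t]η)` are
  `f(x)`, `∂_t f(x)`, `∂_s f(x)`, `∂_s∂_t f(x)` (induction on `f`, Leibniz in `R[η][ε]`).
* `eval_pderiv_pderiv_det_eq_jet` — for an AFFINE square matrix `A`:
  `∂_s ∂_t det A (x)` is the `εη`-coefficient of `det (B + ε X + η Y)` over `R[η][ε]`, with
  `B = A(x)`, `X = ∂_s A (x)`, `Y = ∂_t A (x)` (constant matrices over `R`).

HONEST FRAMING: formal calculus; no stub of the line is closed; VP ≠ VNP is not moved.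

References: folklore (dual numbers / truncated Taylor expansion); used towards
T. Mignon, N. Ressayre, IMRN 2004:79, §2 over coefficient algebras [MignonRessayre2004].
-/

noncomputable section

open MvPolynomial Matrix

-- single-conjunct layout `Summits/ValiantsHypothesis/ValiantsHypothesis`: duplicated namespace by design
set_option linter.dupNamespace false

namespace Summit.ValiantsHypothesis.ValiantsHypothesis.Theorems.GrenetZeonPolySizeQPAlgebra

section JetRing

variable {R : Type*} [CommRing R]

/-- Components of a product in `R[η][ε]`: the constant part. [folklore] -/
theorem fst_fst_mul (z w : DualNumber (DualNumber R)) :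
    (z * w).fst.fst = z.fst.fst * w.fst.fst := by
  rw [TrivSqZeroExt.fst_mul, TrivSqZeroExt.fst_mul]

/-- Components of a product in `R[η][ε]`: the `η`-part. [folklore] -/
theorem fst_snd_mul (z w : DualNumber (DualNumber R)) :
    (z * w).fst.snd = z.fst.fst * w.fst.snd + z.fst.snd * w.fst.fst := by
  rw [TrivSqZeroExt.fst_mul, DualNumber.snd_mul]

/-- Components of a product in `R[η][ε]`: the `ε`-part. [folklore] -/
theorem snd_fst_mul (z w : DualNumber (DualNumber R)) :
    (z * w).snd.fst = z.fst.fst * w.snd.fst + z.snd.fst * w.fst.fst := by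
  rw [DualNumber.snd_mul, TrivSqZeroExt.fst_add, TrivSqZeroExt.fst_mul, TrivSqZeroExt.fst_mul]

/-- Components of a product in `R[η][ε]`: the `εη`-part. [folklore] -/
theorem snd_snd_mul (z w : DualNumber (DualNumber R)) :
    (z * w).snd.snd = z.fst.fst * w.snd.snd + z.fst.snd * w.snd.fst +
      (z.snd.fst * w.fst.snd + z.snd.snd * w.fst.fst) := by
  rw [DualNumber.snd_mul, TrivSqZeroExt.snd_add, DualNumber.snd_mul, DualNumber.snd_mul]

/-- Components of `algebraMap R R[η][ε] r`. [folklore] -/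
theorem algebraMap_jet_eq (r : R) :
    algebraMap R (DualNumber (DualNumber R)) r =
      TrivSqZeroExt.inl (TrivSqZeroExt.inl r) := by
  rw [TrivSqZeroExt.algebraMap_eq_inl', TrivSqZeroExt.algebraMap_eq_inl]

end JetRing

section Taylor

variable {σ : Type*} [DecidableEq σ] {R : Type*} [CommRing R]

/-- **Second-order Taylor expansion through `R[η][ε]`.**  Substituting
`X_u ↦ x_u + [u = s] ε + [u = t] η` into `f` gives the jet
`f(x) + ∂_t f(x) η + ∂_s f(x) ε + ∂_s ∂_t f(x) εη` (also for `s = t`, where `(ε + η)² = 2εη`).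
[folklore] -/
theorem aeval_jet₂_eq (x : σ → R) (s t : σ) (f : MvPolynomial σ R) :
    (aeval (fun u => algebraMap R (DualNumber (DualNumber R)) (x u) +
        (if u = s then DualNumber.eps else 0) +
        (if u = t then algebraMap (DualNumber R) (DualNumber (DualNumber R)) DualNumber.eps
          else 0)) f).fst.fst = eval x f ∧
    (aeval (fun u => algebraMap R (DualNumber (DualNumber R)) (x u) +
        (if u = s then DualNumber.eps else 0) +
        (if u = t then algebraMap (DualNumber R) (DualNumber (DualNumber R)) DualNumber.eps
          else 0)) f).fst.snd = eval x (pderiv t f) ∧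
    (aeval (fun u => algebraMap R (DualNumber (DualNumber R)) (x u) +
        (if u = s then DualNumber.eps else 0) +
        (if u = t then algebraMap (DualNumber R) (DualNumber (DualNumber R)) DualNumber.eps
          else 0)) f).snd.fst = eval x (pderiv s f) ∧
    (aeval (fun u => algebraMap R (DualNumber (DualNumber R)) (x u) +
        (if u = s then DualNumber.eps else 0) +
        (if u = t then algebraMap (DualNumber R) (DualNumber (DualNumber R)) DualNumber.eps
          else 0)) f).snd.snd = eval x (pderiv s (pderiv t f)) := by
  set J : σ → DualNumber (DualNumber R) := fun u => algebraMap R (DualNumber (DualNumber R)) (x u) +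
        (if u = s then DualNumber.eps else 0) +
        (if u = t then algebraMap (DualNumber R) (DualNumber (DualNumber R)) DualNumber.eps
          else 0) with hJ
  -- components of `J u`
  have hJ1 : ∀ u, (J u).fst.fst = x u := by
    intro u
    simp only [hJ, TrivSqZeroExt.fst_add, algebraMap_jet_eq, TrivSqZeroExt.fst_inl]
    split_ifs <;> simp [TrivSqZeroExt.algebraMap_eq_inl]
  have hJ2 : ∀ u, (J u).fst.snd = if u = t then 1 else 0 := by
    intro u
    simp only [hJ, TrivSqZeroExt.fst_add, algebraMap_jet_eq, TrivSqZeroExt.fst_inl]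
    split_ifs <;> simp [TrivSqZeroExt.algebraMap_eq_inl]
  have hJ3 : ∀ u, (J u).snd.fst = if u = s then 1 else 0 := by
    intro u
    simp only [hJ, TrivSqZeroExt.snd_add, algebraMap_jet_eq, TrivSqZeroExt.snd_inl]
    split_ifs <;> simp [TrivSqZeroExt.algebraMap_eq_inl]
  have hJ4 : ∀ u, (J u).snd.snd = 0 := by
    intro u
    simp only [hJ, TrivSqZeroExt.snd_add, algebraMap_jet_eq, TrivSqZeroExt.snd_inl]
    split_ifs <;> simp [TrivSqZeroExt.algebraMap_eq_inl]
  induction f using MvPolynomial.induction_on with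
  | C a =>
    simp only [aeval_C, algebraMap_jet_eq, TrivSqZeroExt.fst_inl, TrivSqZeroExt.snd_inl,
      eval_C, pderiv_C, map_zero, TrivSqZeroExt.fst_zero, TrivSqZeroExt.snd_zero, and_self]
  | add p q hp hq =>
    obtain ⟨hp1, hp2, hp3, hp4⟩ := hp
    obtain ⟨hq1, hq2, hq3, hq4⟩ := hq
    simp only [map_add, TrivSqZeroExt.fst_add, TrivSqZeroExt.snd_add, hp1, hp2, hp3, hp4, hq1,
      hq2, hq3, hq4, and_self]
  | mul_X p u hp =>
    obtain ⟨hp1, hp2, hp3, hp4⟩ := hp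
    have hX : aeval (R := R) J (X u : MvPolynomial σ R) = J u := aeval_X J u
    refine ⟨?_, ?_, ?_, ?_⟩
    · rw [map_mul, fst_fst_mul, hp1, hX, hJ1, map_mul, eval_X]
    · rw [map_mul, fst_snd_mul, hp1, hp2, hX, hJ1, hJ2, Derivation.leibniz, pderiv_X]
      simp only [smul_eq_mul, map_add, map_mul, eval_X, Pi.single_apply]
      split_ifs <;> simp <;> ring
    · rw [map_mul, snd_fst_mul, hp1, hp3, hX, hJ1, hJ3, Derivation.leibniz, pderiv_X]
      simp only [smul_eq_mul, map_add, map_mul, eval_X, Pi.single_apply]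
      split_ifs <;> simp <;> ring
    · rw [map_mul, snd_snd_mul, hp1, hp2, hp3, hp4, hX, hJ1, hJ2, hJ3, hJ4]
      rw [Derivation.leibniz, pderiv_X, smul_eq_mul, smul_eq_mul, map_add, Derivation.leibniz,
        Derivation.leibniz]
      simp only [smul_eq_mul, map_add, map_mul, eval_X, Pi.single_apply, pderiv_X]
      split_ifs <;> simp <;> ring

end Taylor

section JetRing2

variable {R : Type*} [CommRing R]

/-- `ε² = 0` in `R[η][ε]`. [folklore] -/
theorem eps_mul_eps_jet :
    (DualNumber.eps : DualNumber (DualNumber R)) * DualNumber.eps = 0 :=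
  DualNumber.eps_mul_eps

/-- `η² = 0` in `R[η][ε]`. [folklore] -/
theorem eta_mul_eta_jet :
    algebraMap (DualNumber R) (DualNumber (DualNumber R)) DualNumber.eps *
      algebraMap (DualNumber R) (DualNumber (DualNumber R)) DualNumber.eps = 0 := by
  rw [← map_mul, DualNumber.eps_mul_eps, map_zero]

/-- Components of `ε`. [folklore] -/
theorem eps_jet_components :
    (DualNumber.eps : DualNumber (DualNumber R)).fst.fst = 0 ∧
    (DualNumber.eps : DualNumber (DualNumber R)).fst.snd = 0 ∧
    (DualNumber.eps : DualNumber (DualNumber R)).snd.fst = 1 ∧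
    (DualNumber.eps : DualNumber (DualNumber R)).snd.snd = 0 := by
  simp only [DualNumber.fst_eps, DualNumber.snd_eps, TrivSqZeroExt.fst_zero, TrivSqZeroExt.snd_zero,
    TrivSqZeroExt.fst_one, TrivSqZeroExt.snd_one, and_self]

/-- Components of `η`. [folklore] -/
theorem eta_jet_components :
    (algebraMap (DualNumber R) (DualNumber (DualNumber R)) DualNumber.eps).fst.fst = 0 ∧
    (algebraMap (DualNumber R) (DualNumber (DualNumber R)) DualNumber.eps).fst.snd = 1 ∧
    (algebraMap (DualNumber R) (DualNumber (DualNumber R)) DualNumber.eps).snd.fst = 0 ∧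
    (algebraMap (DualNumber R) (DualNumber (DualNumber R)) DualNumber.eps).snd.snd = 0 := by
  simp only [TrivSqZeroExt.algebraMap_eq_inl, TrivSqZeroExt.fst_inl, TrivSqZeroExt.snd_inl,
    DualNumber.fst_eps, DualNumber.snd_eps, TrivSqZeroExt.fst_zero, TrivSqZeroExt.snd_zero, and_self]

/-- Components of a constant `algebraMap R R[η][ε] r`. [folklore] -/
theorem algebraMap_jet_components (r : R) :
    (algebraMap R (DualNumber (DualNumber R)) r).fst.fst = r ∧
    (algebraMap R (DualNumber (DualNumber R)) r).fst.snd = 0 ∧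
    (algebraMap R (DualNumber (DualNumber R)) r).snd.fst = 0 ∧
    (algebraMap R (DualNumber (DualNumber R)) r).snd.snd = 0 := by
  simp [algebraMap_jet_eq]

end JetRing2

section TaylorDet

variable {σ : Type*} [DecidableEq σ] {R : Type*} [CommRing R] {ι : Type*} [Fintype ι] [DecidableEq ι]

open Literature.Computability.AlgebraicComplexity in
/-- **Second partials of an affine determinant through `R[η][ε]`.**  For a square matrix `A` of
affine forms over `R` and a point `x`, the value `∂_s ∂_t det A (x)` is the `εη`-coefficient of
`det (B + ε X + η Y)` computed over `R[η][ε]`, where `B = A(x)`, `X = ∂_s A (x)`, `Y = ∂_t A (x)`.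
[folklore] -/
theorem eval_pderiv_pderiv_det_eq_jet (x : σ → R) (s t : σ) (A : Matrix ι ι (MvPolynomial σ R))
    (hA : ∀ i j, (A i j).totalDegree ≤ 1) :
    eval x (pderiv s (pderiv t A.det)) =
      (((A.map (eval x)).map (algebraMap R (DualNumber (DualNumber R))) +
        (DualNumber.eps : DualNumber (DualNumber R)) •
          (A.map fun a => eval x (pderiv s a)).map (algebraMap R (DualNumber (DualNumber R))) +
        algebraMap (DualNumber R) (DualNumber (DualNumber R)) DualNumber.eps •
          (A.map fun a => eval x (pderiv t a)).map
            (algebraMap R (DualNumber (DualNumber R)))).det).snd.snd := by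
  set J : σ → DualNumber (DualNumber R) := fun u =>
    algebraMap R (DualNumber (DualNumber R)) (x u) +
        (if u = s then DualNumber.eps else 0) +
        (if u = t then algebraMap (DualNumber R) (DualNumber (DualNumber R)) DualNumber.eps
          else 0) with hJ
  have hdet : (A.map (aeval J)).det = aeval J A.det := by
    rw [← AlgHom.coe_toRingHom, ← RingHom.mapMatrix_apply, ← RingHom.map_det]
  have hmat : A.map (aeval J) =
      (A.map (eval x)).map (algebraMap R (DualNumber (DualNumber R))) +
        (DualNumber.eps : DualNumber (DualNumber R)) •
          (A.map fun a => eval x (pderiv s a)).map (algebraMap R (DualNumber (DualNumber R))) +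
        algebraMap (DualNumber R) (DualNumber (DualNumber R)) DualNumber.eps •
          (A.map fun a => eval x (pderiv t a)).map
            (algebraMap R (DualNumber (DualNumber R))) := by
    ext i j
    · -- fst.fst
      have h := (aeval_jet₂_eq x s t (A i j)).1
      simp only [Matrix.map_apply] at h ⊢
      rw [h]
      simp [Matrix.add_apply, Matrix.smul_apply, algebraMap_jet_components]
    · have h := (aeval_jet₂_eq x s t (A i j)).2.1
      simp only [Matrix.map_apply] at h ⊢
      rw [h]
      simp [Matrix.add_apply, Matrix.smul_apply, algebraMap_jet_components]
    · have h := (aeval_jet₂_eq x s t (A i j)).2.2.1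
      simp only [Matrix.map_apply] at h ⊢
      rw [h]
      simp [Matrix.add_apply, Matrix.smul_apply, algebraMap_jet_components]
    · have h := (aeval_jet₂_eq x s t (A i j)).2.2.2
      simp only [Matrix.map_apply] at h ⊢
      rw [h, pderiv_pderiv_eq_zero_of_totalDegree_le_one (hA i j)]
      simp [Matrix.add_apply, Matrix.smul_apply, algebraMap_jet_components]
  rw [← (aeval_jet₂_eq x s t A.det).2.2.2]
  change (aeval J A.det).snd.snd = _
  rw [← hdet, hmat]

end TaylorDet

end Summit.ValiantsHypothesis.ValiantsHypothesis.Theorems.GrenetZeonPolySizeQPAlgebra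

end
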